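import Summits.RiemannHypothesis.RiemannHypothesis.Theses.RuelleBand
import Literature.NumberTheory.LFunctions.ZetaUniversalityDisc
import Literature.NumberTheory.LFunctions.ZetaUniversalityDiscMain
import Literature.Barriers.RiemannHypothesis.BohrDenseValues
import Literature.NumberTheory.LFunctions.GeneralizedRH
import HarnessLib

/-!
# Ideator-2 sketch for crux `ZetaWeakRecurrence` (stmt-RiemannHypothesis-18110, route RuelleBand)

First lemmas of the two crux idea cards filed by this seat (round 1, ideator k = 2):

* card `zeta-prime-offset`: `ZetaDerivStrongRecurrence` (ζ' is strongly recurrent on EVERY closed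
  disc of the open half-strip, unconditionally — PROVED below from the tree's disc universality
  `Steuding2007_thm1_9_discAnalytic_holds` and Cauchy's estimate, because `ζ' = (ζ + C)'` with
  `ζ + C` non-vanishing), the scalar residue `OffsetRecurrence`, and the reduction
  `zetaWeakRecurrence_of_offsetRecurrence` (PROVED: mean-value inequality on the convex disc);
* card `early-prime-resonance`: the Gaussian prime wave `primeWave u T` and the dictionary
  statement `EarlyAnomalyForcesZero` (typed only; provable from the tree's Weil explicit formula).
-/

set_option linter.dupNamespace false

noncomputable section

open Complex Set Metric Filter MeasureTheory

namespace Summit.RiemannHypothesis.RiemannHypothesis.Cruxes.ZetaWeakRecurrence.Ideator2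

open Summit.RiemannHypothesis.RiemannHypothesis.Theses.RuelleBand
open Literature.Barriers.RiemannHypothesis Literature.NumberTheory.LFunctions

/-! ## Card `zeta-prime-offset` -/

/-- STRONG recurrence of `ζ'` on every closed disc `|s − z| ≤ r` of the open half-strip
`1/2 < σ < 1` (positive lower density of the returning shifts), with NO hypothesis on zeros of
`ζ` in the disc. [this seat] -/
def ZetaDerivStrongRecurrence : Prop :=
  ∀ (z : ℂ) (r : ℝ), 0 < r → r < min (z.re - 1 / 2) (1 - z.re) → ∀ ε : ℝ, 0 < ε →
    HasPosLowerDensity {τ : ℝ | ∀ s ∈ closedBall z r,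
      ‖deriv riemannZeta (s + τ * I) - deriv riemannZeta s‖ < ε}

/-- OFFSET RECURRENCE (the scalar residue of WR): a late shift `τ` that is a return of `ζ'` on
the disc AND a return of the single complex number `ζ(z)` at the centre. [this seat] -/
def OffsetRecurrence : Prop :=
  ∀ (z : ℂ) (r : ℝ), 0 < r → r < min (z.re - 1 / 2) (1 - z.re) → ∀ ε : ℝ, 0 < ε → ∀ T : ℝ,
    ∃ τ : ℝ, T ≤ τ ∧
      (∀ s ∈ closedBall z r, ‖deriv riemannZeta (s + τ * I) - deriv riemannZeta s‖ < ε) ∧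
      ‖riemannZeta (z + τ * I) - riemannZeta z‖ < ε

/-- points of a closed disc of the half-strip have real part `< 1` -/
lemma re_lt_one_of_mem_closedBall {z s : ℂ} {r : ℝ} (hr : r < 1 - z.re)
    (hs : s ∈ closedBall z r) : s.re < 1 := by
  rw [mem_closedBall, dist_eq_norm] at hs
  have h := (abs_re_le_norm (s - z)).trans hs
  rw [sub_re, abs_le] at h
  linarith [h.2]

/-- `w ↦ ζ(w + iτ) − ζ(w) − C` has derivative `ζ'(w + iτ) − ζ'(w)` at every `w` with `Re w < 1`. -/
lemma hasDerivAt_shiftDiff {w : ℂ} (hw : w.re < 1) (τ : ℝ) (C : ℂ) :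
    HasDerivAt (fun v ↦ riemannZeta (v + τ * I) - riemannZeta v - C)
      (deriv riemannZeta (w + τ * I) - deriv riemannZeta w) w := by
  have h1 : w ≠ 1 := fun h ↦ by simp [h] at hw
  have h2 : w + τ * I ≠ 1 := fun h ↦ by
    have := congrArg Complex.re h
    simp at this
    linarith
  have hζτ : HasDerivAt (fun v ↦ riemannZeta (v + τ * I)) (deriv riemannZeta (w + τ * I)) w :=
    (differentiableAt_riemannZeta h2).hasDerivAt.comp_add_const w (τ * I)
  have hζ : HasDerivAt riemannZeta (deriv riemannZeta w) w :=
    (differentiableAt_riemannZeta h1).hasDerivAt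
  simpa using (hζτ.sub hζ).sub_const C

/-- **`ζ'` is strongly recurrent on every disc of the open strip, unconditionally.**
Proof: with `C := M + 1`, `M = max_{|s−z|≤ρ} |ζ|`, the target `g = ζ + C` is non-vanishing on the
closed disc of radius `ρ ∈ (r, min(Re z − 1/2, 1 − Re z))`, so disc universality
(`Steuding2007_thm1_9_discAnalytic_holds`) gives a set of shifts of positive lower density with
`max_{|s−z|≤ρ} |ζ(s+iτ) − ζ(s) − C| < ε(ρ−r)/2`; Cauchy's estimate on the circles `|w − s| = ρ − r`
turns this into `max_{|s−z|≤r} |ζ'(s+iτ) − ζ'(s)| ≤ ε/2 < ε`. [this seat] -/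
theorem zetaDerivStrongRecurrence_holds : ZetaDerivStrongRecurrence := by
  intro z r hr hrmin ε hε
  have hr1 : r < z.re - 1 / 2 := hrmin.trans_le (min_le_left _ _)
  have hr2 : r < 1 - z.re := hrmin.trans_le (min_le_right _ _)
  set m : ℝ := min (z.re - 1 / 2) (1 - z.re) with hm
  set ρ : ℝ := (r + m) / 2 with hρ
  set R : ℝ := (ρ + m) / 2 with hR
  have hρr : r < ρ := by rw [hρ]; linarith
  have hρm : ρ < m := by rw [hρ]; linarith
  have hρR : ρ < R := by rw [hR]; linarith
  have hRm : R < m := by rw [hR]; linarith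
  have hρpos : 0 < ρ := hr.trans hρr
  have hρ1 : 1 / 2 < z.re - ρ := by
    have : m ≤ z.re - 1 / 2 := min_le_left _ _
    linarith
  have hρ2 : z.re + ρ < 1 := by
    have : m ≤ 1 - z.re := min_le_right _ _
    linarith
  have hR2 : z.re + R < 1 := by
    have : m ≤ 1 - z.re := min_le_right _ _
    linarith
  -- a bound `M` for `|ζ|` on the closed `ρ`-disc
  have hcont : ContinuousOn riemannZeta (closedBall z ρ) := by
    intro s hs
    have hs1 : s ≠ 1 := by
      intro h
      have := re_lt_one_of_mem_closedBall (by linarith : ρ < 1 - z.re) hs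
      rw [h, one_re] at this
      exact lt_irrefl _ this
    exact (differentiableAt_riemannZeta hs1).continuousAt.continuousWithinAt
  obtain ⟨M, hM⟩ := (isCompact_closedBall z ρ).exists_bound_of_continuousOn hcont
  have hM0 : 0 ≤ M := (norm_nonneg _).trans (hM z (mem_closedBall_self hρpos.le))
  set C : ℂ := ((M + 1 : ℝ) : ℂ) with hC
  set g : ℂ → ℂ := fun s ↦ riemannZeta s + C with hg
  have hgd : DifferentiableOn ℂ g (ball z R) := by
    intro s hs
    have hs1 : s ≠ 1 := by
      intro h
      rw [h, mem_ball, dist_eq_norm] at hs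
      have h1 := abs_re_le_norm ((1 : ℂ) - z)
      rw [sub_re, one_re, abs_of_nonneg (by linarith)] at h1
      linarith
    exact ((differentiableAt_riemannZeta hs1).add_const C).differentiableWithinAt
  have hg0 : ∀ s ∈ closedBall z ρ, g s ≠ 0 := by
    intro s hs h0
    have h1 : riemannZeta s = -C := eq_neg_of_add_eq_zero_left h0
    have h2 : ‖riemannZeta s‖ = M + 1 := by
      rw [h1, norm_neg, hC, Complex.norm_real, Real.norm_eq_abs, abs_of_nonneg (by linarith)]
    linarith [hM s hs]
  -- disc universality for the non-vanishing target `g = ζ + C`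
  set η : ℝ := ε * (ρ - r) / 2 with hη
  have hηpos : 0 < η := by rw [hη]; exact div_pos (mul_pos hε (by linarith)) two_pos
  obtain ⟨δ, hδ, T₀, hT₀⟩ :=
    Steuding2007_thm1_9_discAnalytic_holds z ρ R hρpos hρR hρ1 hρ2 g hgd hg0 η hηpos
  have hpos : HasPosLowerDensity
      {τ : ℝ | ∀ s ∈ closedBall z ρ, ‖riemannZeta (s + τ * I) - g s‖ < η} := ⟨δ, hδ, T₀, hT₀⟩
  refine hpos.mono ?_
  intro τ hτ s hs
  -- Cauchy's estimate for `f = ζ(· + iτ) − ζ − C` on the circle `|w − s| = ρ − r`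
  have hsub : closedBall s (ρ - r) ⊆ closedBall z ρ := by
    intro w hw
    rw [mem_closedBall] at hw hs ⊢
    linarith [dist_triangle w s z]
  have hdiff : DiffContOnCl ℂ (fun v ↦ riemannZeta (v + τ * I) - riemannZeta v - C)
      (ball s (ρ - r)) := by
    refine DifferentiableOn.diffContOnCl ?_
    rw [closure_ball s (by linarith : ρ - r ≠ 0)]
    intro w hw
    have hw1 : w.re < 1 := re_lt_one_of_mem_closedBall (by linarith : ρ < 1 - z.re) (hsub hw)
    exact (hasDerivAt_shiftDiff hw1 τ C).differentiableAt.differentiableWithinAt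
  have hbd : ∀ w ∈ sphere s (ρ - r),
      ‖riemannZeta (w + τ * I) - riemannZeta w - C‖ ≤ η := by
    intro w hw
    have hw' : w ∈ closedBall z ρ := hsub (sphere_subset_closedBall hw)
    have := hτ w hw'
    simp only [hg] at this
    rw [← sub_sub] at this
    exact this.le
  have hcauchy := Complex.norm_deriv_le_of_forall_mem_sphere_norm_le (by linarith : 0 < ρ - r)
    hdiff hbd
  have hs1 : s.re < 1 := re_lt_one_of_mem_closedBall (by linarith : r < 1 - z.re) hs
  rw [(hasDerivAt_shiftDiff hs1 τ C).deriv] at hcauchy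
  have hne : ρ - r ≠ 0 := ne_of_gt (by linarith)
  calc ‖deriv riemannZeta (s + τ * I) - deriv riemannZeta s‖ ≤ η / (ρ - r) := hcauchy
    _ = ε / 2 := by rw [hη, div_right_comm, mul_div_assoc, div_self hne, mul_one]
    _ < ε := half_lt_self hε

/-- **REDUCTION: offset recurrence implies the crux.** On the convex disc, the function
`F(w) = ζ(w + iτ) − ζ(w)` has `|F'| < ε'` (return of `ζ'`), so `|F(s) − F(z)| ≤ ε' r`
(mean-value inequality), and `|F(z)| < ε'` (return of the centre value); with `ε' = ε/(r+2)`
this gives `max_{|s−z|≤r} |ζ(s+iτ) − ζ(s)| < ε`. [this seat] -/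
theorem zetaWeakRecurrence_of_offsetRecurrence (h : OffsetRecurrence) : ZetaWeakRecurrence := by
  intro z r hr hrmin ε hε T
  have hr2 : r < 1 - z.re := hrmin.trans_le (min_le_right _ _)
  set ε' : ℝ := ε / (r + 2) with hε'
  have hε'pos : 0 < ε' := div_pos hε (by linarith)
  obtain ⟨τ, hTτ, hder, hval⟩ := h z r hr hrmin ε' hε'pos T
  refine ⟨τ, hTτ, fun s hs ↦ ?_⟩
  set F : ℂ → ℂ := fun w ↦ riemannZeta (w + τ * I) - riemannZeta w - 0 with hF
  have hFd : ∀ w ∈ closedBall z r, DifferentiableAt ℂ F w := fun w hw ↦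
    (hasDerivAt_shiftDiff (re_lt_one_of_mem_closedBall hr2 hw) τ 0).differentiableAt
  have hFb : ∀ w ∈ closedBall z r, ‖deriv F w‖ ≤ ε' := by
    intro w hw
    rw [hF, (hasDerivAt_shiftDiff (re_lt_one_of_mem_closedBall hr2 hw) τ 0).deriv]
    exact (hder w hw).le
  have hmv := (convex_closedBall z r).norm_image_sub_le_of_norm_deriv_le hFd hFb
    (mem_closedBall_self hr.le) hs
  have hsz : ‖s - z‖ ≤ r := by rwa [mem_closedBall, dist_eq_norm] at hs
  have hFz : ‖F z‖ < ε' := by simpa [hF] using hval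
  have hFs : ‖F s‖ ≤ ‖F s - F z‖ + ‖F z‖ := norm_le_norm_sub_add _ _
  have hkey : ‖F s‖ < ε' * r + ε' := by
    have h1 : ‖F s - F z‖ ≤ ε' * r := hmv.trans (mul_le_mul_of_nonneg_left hsz hε'pos.le)
    linarith
  have hfin : ε' * r + ε' < ε := by
    have : ε' * (r + 2) = ε := by rw [hε']; field_simp
    nlinarith
  have : F s = riemannZeta (s + τ * I) - riemannZeta s := by simp [hF]
  rw [← this]
  linarith

/-- THE UNCONDITIONAL HALF OF WR (Voronin; copy of the strategist's
`weakRecurrence_of_zeroFree`, Cruxes/ExactFirstBand/StrategySketch.lean): on a zero-free closed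
disc of the strip `ζ` is (strongly, hence weakly) recurrent. [cite: Steuding2007, Thm. 1.9] -/
theorem weakRecurrence_of_zeroFree {z : ℂ} {r : ℝ} (hr : 0 < r)
    (hrmin : r < min (z.re - 1 / 2) (1 - z.re))
    (hZ : ∀ s ∈ closedBall z r, riemannZeta s ≠ 0) :
    ∀ ε : ℝ, 0 < ε → ∀ T : ℝ, ∃ τ : ℝ, T ≤ τ ∧
      ∀ s ∈ closedBall z r, ‖riemannZeta (s + τ * I) - riemannZeta s‖ < ε := by
  intro ε hε T
  have hr1 : r < z.re - 1 / 2 := hrmin.trans_le (min_le_left _ _)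
  have hr2 : r < 1 - z.re := hrmin.trans_le (min_le_right _ _)
  set R : ℝ := (r + (1 - z.re)) / 2 with hR
  have hrR : r < R := by rw [hR]; linarith
  have hRlt : z.re + R < 1 := by rw [hR]; linarith
  have hdiff : DifferentiableOn ℂ riemannZeta (ball z R) := by
    intro s hs
    have hs1 : s ≠ 1 := by
      rintro rfl
      rw [mem_ball, dist_eq_norm] at hs
      have h1 := abs_re_le_norm ((1 : ℂ) - z)
      rw [sub_re, one_re, abs_of_nonneg (by linarith)] at h1
      linarith
    exact (differentiableAt_riemannZeta hs1).differentiableWithinAt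
  obtain ⟨δ, hδ, T₀, hT₀⟩ := Steuding2007_thm1_9_discAnalytic_holds z r R hr hrR (by linarith)
    (by linarith) riemannZeta hdiff hZ ε hε
  have hpos : HasPosLowerDensity
      {τ : ℝ | ∀ s ∈ closedBall z r, ‖riemannZeta (s + τ * I) - riemannZeta s‖ < ε} :=
    ⟨δ, hδ, T₀, hT₀⟩
  obtain ⟨τ, hτ, hTτ⟩ := hpos.exists_gt T
  exact ⟨τ, hTτ.le, hτ⟩

/-- TRANSFER TARGET `C⁺` of card `zeta-prime-offset` (values form): for every admissible disc,
every zero `ξ` of `ζ` IN the disc, every `ε` and every height, some late shift is a return of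
`ζ'` on the disc at which the shifted zero position carries a small value, `|ζ(ξ + iτ)| < ε`
(given the `ζ'`-return this is, for a simple zero, the same as a zero of `ζ` within `≍ ε` of
`ξ + iτ`: "the begotten zero lands inside the `ζ'`-return set"). [this seat] -/
def DerivReturnSmallAtZero : Prop :=
  ∀ (z : ℂ) (r : ℝ), 0 < r → r < min (z.re - 1 / 2) (1 - z.re) →
    ∀ ξ ∈ closedBall z r, riemannZeta ξ = 0 → ∀ ε : ℝ, 0 < ε → ∀ T₀ : ℝ, ∃ τ : ℝ, T₀ ≤ τ ∧
      (∀ s ∈ closedBall z r, ‖deriv riemannZeta (s + τ * I) - deriv riemannZeta s‖ < ε) ∧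
      ‖riemannZeta (ξ + τ * I)‖ < ε

/-- **`C⁺ ⟹ crux`**: on a zero-free disc WR is Voronin's theorem; on a disc containing a zero
`ξ`, a `ζ'`-return makes `w ↦ ζ(w+iτ) − ζ(w)` nearly constant on the disc (mean-value
inequality), and its value at `ξ` is `ζ(ξ + iτ)`, which is small. [this seat] -/
theorem zetaWeakRecurrence_of_derivReturnSmallAtZero (h : DerivReturnSmallAtZero) :
    ZetaWeakRecurrence := by
  intro z r hr hrmin ε hε T
  by_cases hZ : ∀ s ∈ closedBall z r, riemannZeta s ≠ 0
  · exact weakRecurrence_of_zeroFree hr hrmin hZ ε hε T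
  push Not at hZ
  obtain ⟨ξ, hξD, hξ0⟩ := hZ
  have hr2 : r < 1 - z.re := hrmin.trans_le (min_le_right _ _)
  set ε' : ℝ := ε / (2 * r + 2) with hε'
  have hε'pos : 0 < ε' := div_pos hε (by linarith)
  obtain ⟨τ, hTτ, hder, hval⟩ := h z r hr hrmin ξ hξD hξ0 ε' hε'pos T
  refine ⟨τ, hTτ, fun s hs ↦ ?_⟩
  set F : ℂ → ℂ := fun w ↦ riemannZeta (w + τ * I) - riemannZeta w - 0 with hF
  have hFd : ∀ w ∈ closedBall z r, DifferentiableAt ℂ F w := fun w hw ↦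
    (hasDerivAt_shiftDiff (re_lt_one_of_mem_closedBall hr2 hw) τ 0).differentiableAt
  have hFb : ∀ w ∈ closedBall z r, ‖deriv F w‖ ≤ ε' := by
    intro w hw
    rw [hF, (hasDerivAt_shiftDiff (re_lt_one_of_mem_closedBall hr2 hw) τ 0).deriv]
    exact (hder w hw).le
  have hmv := (convex_closedBall z r).norm_image_sub_le_of_norm_deriv_le hFd hFb hξD hs
  have hsξ : ‖s - ξ‖ ≤ 2 * r := by
    have h1 : dist s z ≤ r := hs
    have h2 : dist ξ z ≤ r := hξD
    have := dist_triangle_right s ξ z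
    rw [dist_eq_norm] at this
    linarith
  have hFξ : ‖F ξ‖ < ε' := by simpa [hF, hξ0] using hval
  have hFs : ‖F s‖ ≤ ‖F s - F ξ‖ + ‖F ξ‖ := norm_le_norm_sub_add _ _
  have hkey : ‖F s‖ < ε' * (2 * r) + ε' := by
    have h1 : ‖F s - F ξ‖ ≤ ε' * (2 * r) :=
      hmv.trans (mul_le_mul_of_nonneg_left hsξ hε'pos.le)
    linarith
  have hfin : ε' * (2 * r) + ε' < ε := by
    have : ε' * (2 * r + 2) = ε := by rw [hε']; field_simp
    nlinarith
  have : F s = riemannZeta (s + τ * I) - riemannZeta s := by simp [hF]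
  rw [← this]
  linarith

/-! ## Card `early-prime-resonance` -/

/-- The Gaussian prime wave at log-scale `u` and frequency `T`:
`S(u, T) = Σ_n Λ(n) n^{−1/2 − iT} e^{−(log n − u)²}` (absolutely convergent). [this seat] -/
def primeWave (u T : ℝ) : ℂ :=
  ∑' n : ℕ, (ArithmeticFunction.vonMangoldt n : ℂ) *
    ((Real.exp (-(Real.log n - u) ^ 2) : ℝ) : ℂ) * (n : ℂ) ^ (-(1 / 2 + T * I : ℂ))

/-- DICTIONARY, prime side → zero side ("an EARLY large deviation of the prime wave forces a zero
far to the right"): for `1/2 < β < 1` and `ε, c > 0` there are `u₀, κ > 0` such that whenever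
`u₀ ≤ u ≤ T` (so the pole term `≪ e^{u/2 − T²/4}` is negligible), `log T ≤ κ e^{εu}` and `|S(u, T)| ≥ c e^{(β − 1/2)u}`, the zeta function has a
zero `ρ` with `Re ρ ≥ β − 2ε` and `|Im ρ − T| ≤ √(5u)`. (Explicit formula with the Gaussian test
function: the zeros within `√(5u)` of `T` contribute `≪ e^{(θ−1/2)u} log T`, the others and the
pole `≪ log T`.) Typed only. [this seat] -/
def EarlyAnomalyForcesZero : Prop :=
  ∀ (β ε c : ℝ), 1 / 2 < β → β < 1 → 0 < ε → 2 * ε < β - 1 / 2 → 0 < c →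
    ∃ u₀ κ : ℝ, 0 < κ ∧ ∀ u T : ℝ, u₀ ≤ u → u ≤ T → Real.log T ≤ κ * Real.exp (ε * u) →
      c * Real.exp ((β - 1 / 2) * u) ≤ ‖primeWave u T‖ →
        ∃ ρ : ℂ, riemannZeta ρ = 0 ∧ 0 < ρ.re ∧ ρ.re < 1 ∧ β - 2 * ε ≤ ρ.re ∧
          |ρ.im - T| ≤ Real.sqrt (5 * u)

/-- EARLY PRIME-RESONANCE RECURRENCE INSIDE THE `ζ'`-RETURN SETS (the card's transfer target
`C⁺`, stronger than the crux given `zetaDerivStrongRecurrence_holds` + Rouché): for every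
off-line zero `ξ`, every admissible disc about it, every `ε, δ > 0` and height `T₀`, some
shift `τ ≥ T₀` is simultaneously a return of `ζ'` on the disc and carries a zero of `ζ`
within `δ` of `ξ + iτ`. [this seat] -/
def BegottenZerosInDerivReturns : Prop :=
  ∀ (ξ : ℂ) (r : ℝ), riemannZeta ξ = 0 → 0 < r → r < min (ξ.re - 1 / 2) (1 - ξ.re) →
    ∀ ε : ℝ, 0 < ε → ∀ δ : ℝ, 0 < δ → ∀ T₀ : ℝ, ∃ τ : ℝ, T₀ ≤ τ ∧
      (∀ s ∈ closedBall ξ r, ‖deriv riemannZeta (s + τ * I) - deriv riemannZeta s‖ < ε) ∧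
      ∃ ρ : ℂ, riemannZeta ρ = 0 ∧ dist ρ (ξ + τ * I) < δ

/-- OFF-LINE ABSCISSA RECURRENCE ("zeros beget zeros", the weak zero-side shadow of WR that the
route's Rouché glue actually consumes): every off-line abscissa of the right half-strip is
revisited by zeros in every vertical window about it, infinitely often. RH-implied (vacuous);
WR ⟹ this (Rouché, `exists_zero_near_shift`); it is what card `early-prime-resonance` reaches
from the prime side. Recorded for the strategist: with `NoRightInteriorBand` it gives
`ExactFirstBand` in a few lines (`exactFirstBand_of_nrib_of_abscissaRecurrence`). [this seat] -/
def OffLineAbscissaRecurrence : Prop :=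
  ∀ ξ : ℂ, riemannZeta ξ = 0 → 1 / 2 < ξ.re → ξ.re < 1 → ∀ ε : ℝ, 0 < ε →
    {s : ℂ | riemannZeta s = 0 ∧ 0 < s.re ∧ s.re < 1 ∧ |s.re - ξ.re| < ε}.Infinite

/-- The weak shadow already closes the split with NRIB (trivial seam — which is WHY the route
files the value statement WR instead; recorded so that nobody mistakes card
`early-prime-resonance` for a line on WR itself). [this seat] -/
theorem exactFirstBand_of_nrib_of_abscissaRecurrence (hN : NoRightInteriorBand)
    (hZ : OffLineAbscissaRecurrence) : ExactFirstBand := by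
  intro s hs h0 h1
  by_contra hnot
  push Not at hnot
  obtain ⟨hne, -⟩ := hnot
  -- an off-line zero `ξ` in the right half
  obtain ⟨ξ, hξ0, hξhalf, hξ1⟩ : ∃ ξ : ℂ, riemannZeta ξ = 0 ∧ 1 / 2 < ξ.re ∧ ξ.re < 1 := by
    rcases lt_or_gt_of_ne hne with hlt | hgt
    · refine ⟨1 - s, GeneralizedRH.riemannZeta_one_sub_eq_zero hs h0 h1, ?_, ?_⟩
      · simp only [sub_re, one_re]; linarith
      · simp only [sub_re, one_re]; linarith
    · exact ⟨s, hs, hgt, h1⟩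
  obtain ⟨ε, hε, hfin⟩ := hN ξ.re hξhalf hξ1
  exact hZ ξ hξ0 hξhalf hξ1 ε hε hfin

end Summit.RiemannHypothesis.RiemannHypothesis.Cruxes.ZetaWeakRecurrence.Ideator2

end
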